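import Summits.BirchSwinnertonDyer.BirchSwinnertonDyer.Theorems.PrintX6BSTWByName
import Summits.BirchSwinnertonDyer.Rank1Residual.Supersingular.X6RankZeroErratumDefs
import HarnessLib

/-!
# Route `PrintX6` — the road-(E) children `EisensteinHalfFiveLeErr` / `EisensteinHalfFiveLeRest` BY NAME
# from Burungale–Skinner–Tian–Wan 2024 (cell `bsd-print-x6`, seat p1; lane «BSTW Thm 1.3/1.5 BY NAME»)

Filed by p1 gen 6 after planner EDIT #4 (PLAN.md v3.2 / RUNBOOK-edit4): the parent crux `EisensteinHalfFiveLe`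
(stmt-BirchSwinnertonDyer-20276) is split by cases on ty2's `Supersingular.HasErratumPrime W p` (p544776) into the
ATTACKED child `EisensteinHalfFiveLeErr` (anticyclotomic road (E), pack `Supersingular.PublishedAcInputsX6Err` first)
and the RESIDUAL child `EisensteinHalfFiveLeRest` (no erratum prime; at p ≥ 5 reached BY NAME only by
Burungale–Skinner–Tian–Wan 2024, arXiv:2409.01350, Thm. 1.3 / Thm. 1.5 — a PREPRINT). This file pins both children
to the four by-name roads S / P / V / K of `PrintX6BSTWByName.lean` (p541401), one composition each.

HONEST FRAMING. Conditional on the labelled OPEN binders of the PREPRINT arXiv:2409.01350v2 (never discharged)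
plus published facts BY NAME, exactly as `PrintX6BSTWByName.lean` (p541401); no `def`, no named fact, no
restatement. Both children are WEAKENINGS of the parent crux `EisensteinHalfFiveLe` (an extra side hypothesis,
ignored), so every road of p541401 gives them by one composition. PARTITION: 0 cells; BEYOND-PRINT THEOREM: NO.
-/

set_option autoImplicit false
set_option linter.dupNamespace false

noncomputable section

open scoped Classical


open WeierstrassCurve Literature.NumberTheory.EllipticCurves
  Literature.NumberTheory.EllipticCurves.Rank1Residual
  Literature.NumberTheory.EllipticCurves.BurungaleSkinnerTianWan2024
  Summit.BirchSwinnertonDyer.Rank1Residual.Supersingular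
  Summit.BirchSwinnertonDyer.BirchSwinnertonDyer.Theses.PrintX6

namespace Summit.BirchSwinnertonDyer.BirchSwinnertonDyer.Theorems.PrintX6

/-! ### §0 Both road-(E) children are weakenings of the parent crux (pure logic) -/

/-- The residual child `EisensteinHalfFiveLeRest` (¬`HasErratumPrime` sub-class) is the parent crux
`EisensteinHalfFiveLe` with one extra, unused hypothesis. Pure logic; unconditional. -/
theorem eisensteinHalfFiveLeRest_of_eisensteinHalfFiveLe (h : EisensteinHalfFiveLe) : EisensteinHalfFiveLeRest :=
  fun W _ _ p _ hCM h5 hX h0 _ q hq hv ↦ h W p hCM h5 hX h0 q hq hv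

/-- The attacked child `EisensteinHalfFiveLeErr` (`HasErratumPrime` sub-class, under the anticyclotomic pack) is
likewise the parent crux with two extra, unused hypotheses. Pure logic; unconditional. -/
theorem eisensteinHalfFiveLeErr_of_eisensteinHalfFiveLe (h : EisensteinHalfFiveLe) : EisensteinHalfFiveLeErr :=
  fun _ W _ _ p _ hCM h5 hX h0 _ q hq hv ↦ h W p hCM h5 hX h0 q hq hv

/-! ### §1 Road S — the `p ≥ 5` S-scoped tier -/

/-- **`EisensteinHalfFiveLeRest` BY NAME on road S**: `PublishedInputsX6 → diamond1995_refinedSerre →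
thm13_scopedS_OPEN → EisensteinHalfFiveLeRest`, by `eisensteinHalfFiveLe_of_thm13_scopedS_OPEN` (p541401).
CONDITIONAL on ONE PRE binder; the child stays OPEN; not bookable (R-0.1).
[claim: BurungaleSkinnerTianWan2024, status: under-review] [cite: Kobayashi2003, Thm. 1.2 and Conjecture (p. 2)]
[cite: BDKim2013, Cor. 3.15 (p. 199)] [cite: Ribet1990, Thm. 1.1] [cite: Miller2011LMS, Def. 1.1] -/
theorem eisensteinHalfFiveLeRest_of_thm13_scopedS_OPEN (hPub : PublishedInputsX6)
    (hLL : Literature.NumberTheory.Automorphic.diamond1995_refinedSerre)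
    (h5t : BurungaleSkinnerTianWan2024_thm13_scopedS_OPEN) : EisensteinHalfFiveLeRest :=
  eisensteinHalfFiveLeRest_of_eisensteinHalfFiveLe (eisensteinHalfFiveLe_of_thm13_scopedS_OPEN hPub hLL h5t)

/-- **`EisensteinHalfFiveLeErr` BY NAME on road S** (the pack binder unused): CONDITIONAL on ONE PRE binder.
[claim: BurungaleSkinnerTianWan2024, status: under-review] [cite: Kobayashi2003, Thm. 1.2 and Conjecture (p. 2)]
[cite: BDKim2013, Cor. 3.15 (p. 199)] [cite: Ribet1990, Thm. 1.1] [cite: Miller2011LMS, Def. 1.1] -/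
theorem eisensteinHalfFiveLeErr_of_thm13_scopedS_OPEN (hPub : PublishedInputsX6)
    (hLL : Literature.NumberTheory.Automorphic.diamond1995_refinedSerre)
    (h5t : BurungaleSkinnerTianWan2024_thm13_scopedS_OPEN) : EisensteinHalfFiveLeErr :=
  eisensteinHalfFiveLeErr_of_eisensteinHalfFiveLe (eisensteinHalfFiveLe_of_thm13_scopedS_OPEN hPub hLL h5t)

/-! ### §2 Road P — Thm. 1.3 as printed -/

/-- **`EisensteinHalfFiveLeRest` BY NAME on road P**: `PublishedInputsX6 → thm13_OPEN → EisensteinHalfFiveLeRest`.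
CONDITIONAL; the child stays OPEN. [claim: BurungaleSkinnerTianWan2024, status: under-review]
[cite: Kobayashi2003, Thm. 1.2 and Conjecture (p. 2)] [cite: BDKim2013, Cor. 3.15 (p. 199)] [cite: Miller2011LMS, Def. 1.1] -/
theorem eisensteinHalfFiveLeRest_of_thm13_OPEN (hPub : PublishedInputsX6)
    (h13 : BurungaleSkinnerTianWan2024_thm13_OPEN) : EisensteinHalfFiveLeRest :=
  eisensteinHalfFiveLeRest_of_eisensteinHalfFiveLe (eisensteinHalfFiveLe_of_thm13_OPEN hPub h13)

/-- **`EisensteinHalfFiveLeErr` BY NAME on road P**. CONDITIONAL. [claim: BurungaleSkinnerTianWan2024, status: under-review]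
[cite: Kobayashi2003, Thm. 1.2 and Conjecture (p. 2)] [cite: BDKim2013, Cor. 3.15 (p. 199)] [cite: Miller2011LMS, Def. 1.1] -/
theorem eisensteinHalfFiveLeErr_of_thm13_OPEN (hPub : PublishedInputsX6)
    (h13 : BurungaleSkinnerTianWan2024_thm13_OPEN) : EisensteinHalfFiveLeErr :=
  eisensteinHalfFiveLeErr_of_eisensteinHalfFiveLe (eisensteinHalfFiveLe_of_thm13_OPEN hPub h13)

/-! ### §3 Road V — Thm. 1.5 (value statement) + GZK -/

/-- **`EisensteinHalfFiveLeRest` BY NAME on road V**: `thm15_pPart_OPEN → GZK → EisensteinHalfFiveLeRest` (minimal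
binder set). CONDITIONAL. [claim: BurungaleSkinnerTianWan2024, status: under-review] [cite: Miller2011LMS, §1 and Def. 1.1] -/
theorem eisensteinHalfFiveLeRest_of_thm15_OPEN (h15 : thm15_pPart_OPEN)
    (hGZK : rank_eq_analyticRank_of_analyticRank_le_one) : EisensteinHalfFiveLeRest :=
  eisensteinHalfFiveLeRest_of_eisensteinHalfFiveLe (eisensteinHalfFiveLe_of_thm15_OPEN h15 hGZK)

/-- **`EisensteinHalfFiveLeErr` BY NAME on road V**. CONDITIONAL. [claim: BurungaleSkinnerTianWan2024, status: under-review]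
[cite: Miller2011LMS, §1 and Def. 1.1] -/
theorem eisensteinHalfFiveLeErr_of_thm15_OPEN (h15 : thm15_pPart_OPEN)
    (hGZK : rank_eq_analyticRank_of_analyticRank_le_one) : EisensteinHalfFiveLeErr :=
  eisensteinHalfFiveLeErr_of_eisensteinHalfFiveLe (eisensteinHalfFiveLe_of_thm15_OPEN h15 hGZK)

/-! ### §4 Road K — the sister route's crux `KobayashiLowerHalfSemistable` (stmt-BirchSwinnertonDyer-19000) -/

/-- **`EisensteinHalfFiveLeRest` BY NAME from K3's crux BY NAME**: `KobayashiLowerHalfSemistable → PublishedInputsX6 →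
EisensteinHalfFiveLeRest`, by `eisensteinHalves_of_kobayashiLowerHalfSemistable` (p541401). CONDITIONAL on the sister
crux (OPEN); closes nothing. [cite: Kobayashi2003, Thm. 1.2 and Conjecture (p. 2)] [cite: BDKim2013, Cor. 3.15 (p. 199)]
[cite: Miller2011LMS, Def. 1.1] -/
theorem eisensteinHalfFiveLeRest_of_kobayashiLowerHalfSemistable
    (h : Summit.BirchSwinnertonDyer.BirchSwinnertonDyer.Theses.SignedLowerHalves.KobayashiLowerHalfSemistable)
    (hPub : PublishedInputsX6) : EisensteinHalfFiveLeRest :=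
  eisensteinHalfFiveLeRest_of_eisensteinHalfFiveLe (eisensteinHalves_of_kobayashiLowerHalfSemistable h hPub).1

/-- **`EisensteinHalfFiveLeErr` BY NAME from K3's crux BY NAME** (the pack binder unused). CONDITIONAL on the sister
crux (OPEN); closes nothing. [cite: Kobayashi2003, Thm. 1.2 and Conjecture (p. 2)] [cite: BDKim2013, Cor. 3.15 (p. 199)]
[cite: Miller2011LMS, Def. 1.1] -/
theorem eisensteinHalfFiveLeErr_of_kobayashiLowerHalfSemistable
    (h : Summit.BirchSwinnertonDyer.BirchSwinnertonDyer.Theses.SignedLowerHalves.KobayashiLowerHalfSemistable)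
    (hPub : PublishedInputsX6) : EisensteinHalfFiveLeErr :=
  eisensteinHalfFiveLeErr_of_eisensteinHalfFiveLe (eisensteinHalves_of_kobayashiLowerHalfSemistable h hPub).1

end Summit.BirchSwinnertonDyer.BirchSwinnertonDyer.Theorems.PrintX6

end
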